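import Literature.NumberTheory.Automorphic.CMLocalRankOneClassMapOpen     -- ★ F4a (this seat): `exists_nhds_class_local_two_nonsplit`
import Literature.NumberTheory.Rogawski1990.LocalNormFibreNonsplit       -- ★ `IsLocalGRegular.separable_finCharpolyTwo`, `snd_eq_iff_finGammaTwo_eq`, `finCharpolyTwo`, `finGammaTwo`
import HarnessLib

/-!
# SATURATION for the endoscopic group `H_v = U(Φ₂)_v × U(Φ₁)_v` at a non-split place: every `G`-regular class near the class of `ε_H` MEETS any
# neighbourhood of `ε_H` (Langlands–Shelstad, *Descent for transfer factors*, §2.2 p. 11 «because `G` is quasisplit», for `U(2) × U(1)`)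

Topic `NumberTheory/Rogawski1990`; namespace `Literature.NumberTheory.Rogawski1990`.  THEOREMS ONLY (no definition, no instance, no notation, no named
fact, no `sorry`).  Cell `pub/hodgecm-mathlib` (D-0151), crux H413 = stmt-HodgeConjecture-24833, F0∕P3a road «D-N6-ns», floor-2 line «N6nsGerm», stub
`stub_N6nsGlue` SATURATION HALF (LEAD F0P3a-plan (g9) WORD T8-55 → B-p08 (g26)); census file F4 (part 2 = saturation on the endoscopic carrier +
(σ-SEP)).  HONEST LABEL: HC_CM is proved only modulo the 2 remaining named inputs (hLiu418, h413) until rung 0 closes; this file proves no letter.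

THE MATHEMATICS.  The stable class of `γ_H = (g, u) ∈ H_v` is read by the CLASS MAP `π(γ_H) = (χ_g(0)… ) = (coeff₀ χ_g, coeff₁ χ_g, u) ∈ (∏ L_w)³`
(`χ_g = X² − tr g·X + det g`, so `coeff₀ = det g`, `coeff₁ = −tr g`).  §1: `π` is continuous.  §2 (σ-SEP): for `G`-REGULAR `γ_H` (separable
`χ_g·(X − u)`), `π(γ_H) = π(γ_H′)` forces `γ_H ∼_st γ_H′` (two elements of `GL₂(∏ L_w)` with the same separable characteristic polynomial are conjugate,
★ `exists_units_conj_eq_of_charpoly_eq_of_separable`; the `U(Φ₁)` slot is read off `u`).  §3 (σ-SAT): at a NON-SPLIT `v`, for every `ε_H ∈ H_v` and every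
neighbourhood `V ∋ ε_H` there is an OPEN `W ∋ π(ε_H)` such that every `G`-regular `γ_H` with `π(γ_H) ∈ W` is stably conjugate to some `γ_H′ ∈ V` — the
`U(Φ₂)` slot by ★ `exists_nhds_class_local_two_nonsplit` (explicit Borel sections of the quasi-split rank-one unitary group), the `U(Φ₁)` slot because its
topology is induced by the entry `u` (`u⁻¹ = ū`).  This is the hypothesis «saturation» of the glue ★ `exists_stableOrbitalIntegralRel_eq_of_pointwise_of_saturation`.

## References
* [LanglandsShelstad1990Descent] R. P. Langlands, D. Shelstad, *Descent for transfer factors*, Progr. Math. 87 (1990), §2.2 Lemma 2.2.A p. 11.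
* [Rogawski1990] J. D. Rogawski, *Automorphic Representations of Unitary Groups in Three Variables*, Ann. of Math. Stud. 123 (1990), §3.1 p. 19, §4.9 p. 54.
* [HornJohnson2013] R. A. Horn, C. R. Johnson, *Matrix Analysis*, 2nd ed. (2013), 3.3.P12 (same separable characteristic polynomial ⇒ similar).
-/

set_option autoImplicit false

noncomputable section

open NumberField IsDedekindDomain Matrix Polynomial Set Filter Topology
open scoped MatrixGroups

namespace Literature.NumberTheory.Rogawski1990

open Literature.NumberTheory.Automorphic

variable (L : Type) [Field L] [NumberField L] [IsCMField L] (v : HeightOneSpectrum (𝓞 ↥(maximalRealSubfield L)))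

/-! ## §1 The class map `π(γ_H) = (coeff₀ χ_g, coeff₁ χ_g, u)` and its continuity -/

/-- `coeff₀ χ_g = det g` and `coeff₁ χ_g = −tr g` for the `U(Φ₂)`-component. [cite: HornJohnson2013, 1.2 (characteristic polynomial of a 2 × 2 matrix)] -/
theorem finCharpolyTwo_coeff_eq
    (a : (UnitaryGroup.cmDatum L 2 (Matrix.of fun i j : Fin 2 => if i.val + j.val + 1 = 2 then (1 : L) else 0)).Local v ×
      (UnitaryGroup.cmDatum L 1 (Matrix.of fun i j : Fin 1 => if i.val + j.val + 1 = 1 then (1 : L) else 0)).Local v) :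
    (finCharpolyTwo L v a).coeff 0 = ((a.1.val : GL (Fin 2) (UnitaryGroup.LocalRing L v))).val.det ∧
      (finCharpolyTwo L v a).coeff 1 = -((a.1.val : GL (Fin 2) (UnitaryGroup.LocalRing L v))).val.trace := by
  unfold finCharpolyTwo
  constructor
  · rw [Matrix.det_eq_sign_charpoly_coeff]
    simp
  · rw [Matrix.trace_eq_neg_charpoly_coeff]
    simp

/-- The class map `π` is continuous on `H_v`. [cite: Rogawski1990, §4.9 p. 54] -/
theorem continuous_classMapH :
    Continuous fun a : (UnitaryGroup.cmDatum L 2 (Matrix.of fun i j : Fin 2 => if i.val + j.val + 1 = 2 then (1 : L) else 0)).Local v ×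
        (UnitaryGroup.cmDatum L 1 (Matrix.of fun i j : Fin 1 => if i.val + j.val + 1 = 1 then (1 : L) else 0)).Local v =>
      ((finCharpolyTwo L v a).coeff 0, (finCharpolyTwo L v a).coeff 1, finGammaTwo L v a) := by
  have hM : Continuous fun a : (UnitaryGroup.cmDatum L 2 (Matrix.of fun i j : Fin 2 => if i.val + j.val + 1 = 2 then (1 : L) else 0)).Local v ×
        (UnitaryGroup.cmDatum L 1 (Matrix.of fun i j : Fin 1 => if i.val + j.val + 1 = 1 then (1 : L) else 0)).Local v =>
      ((a.1.val : GL (Fin 2) (UnitaryGroup.LocalRing L v))).val :=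
    Units.continuous_val.comp (continuous_subtype_val.comp continuous_fst)
  have hM₂ : Continuous fun a : (UnitaryGroup.cmDatum L 2 (Matrix.of fun i j : Fin 2 => if i.val + j.val + 1 = 2 then (1 : L) else 0)).Local v ×
        (UnitaryGroup.cmDatum L 1 (Matrix.of fun i j : Fin 1 => if i.val + j.val + 1 = 1 then (1 : L) else 0)).Local v =>
      ((a.2.val : GL (Fin 1) (UnitaryGroup.LocalRing L v))).val :=
    Units.continuous_val.comp (continuous_subtype_val.comp continuous_snd)
  have hu : Continuous fun a : (UnitaryGroup.cmDatum L 2 (Matrix.of fun i j : Fin 2 => if i.val + j.val + 1 = 2 then (1 : L) else 0)).Local v ×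
        (UnitaryGroup.cmDatum L 1 (Matrix.of fun i j : Fin 1 => if i.val + j.val + 1 = 1 then (1 : L) else 0)).Local v => finGammaTwo L v a := by
    unfold finGammaTwo
    exact hM₂.matrix_elem 0 0
  unfold finCharpolyTwo
  exact ((Literature.LinearAlgebra.Matrix.continuous_charpoly_coeff 0).comp hM).prodMk
    (((Literature.LinearAlgebra.Matrix.continuous_charpoly_coeff 1).comp hM).prodMk hu)

/-! ## §2 (σ-SEP): `G`-regular elements with the same class are stably conjugate -/

/-- **(σ-SEP).**  If `γ_H` is `G`-regular and `π(γ_H) = π(γ_H′)` (same `χ_g`, same `u`), then `γ_H ∼_st γ_H′` in `H_v`.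
[cite: Rogawski1990, §3.1 p. 19] [cite: HornJohnson2013, 3.3.P12] -/
theorem isLocalStablyConjH_of_finCharpolyTwo_eq_of_finGammaTwo_eq
    {a a' : (UnitaryGroup.cmDatum L 2 (Matrix.of fun i j : Fin 2 => if i.val + j.val + 1 = 2 then (1 : L) else 0)).Local v ×
      (UnitaryGroup.cmDatum L 1 (Matrix.of fun i j : Fin 1 => if i.val + j.val + 1 = 1 then (1 : L) else 0)).Local v}
    (ha : IsLocalGRegular L v a) (hχ : finCharpolyTwo L v a = finCharpolyTwo L v a') (hu : finGammaTwo L v a = finGammaTwo L v a') :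
    IsLocalStablyConjH L v a a' := by
  obtain ⟨c, hc⟩ := Literature.LinearAlgebra.Matrix.exists_units_conj_eq_of_charpoly_eq_of_separable
    (K := fun w : UnitaryGroup.PlacesOver L v => w.1.adicCompletion L)
    (a.1.val : GL (Fin 2) (UnitaryGroup.LocalRing L v)) (a'.1.val : GL (Fin 2) (UnitaryGroup.LocalRing L v))
    (ha.separable_finCharpolyTwo) (by unfold finCharpolyTwo at hχ; exact hχ.symm)
  refine ⟨isConj_iff.2 ⟨c, hc⟩, ?_⟩
  rw [(snd_eq_iff_finGammaTwo_eq L v).2 hu]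
  exact IsStablyConj.refl _

/-- (σ-SEP) in class-map form: `G`-regular `γ_H` and `π(γ_H) = π(γ_H′)` ⇒ `γ_H ∼_st γ_H′`. [cite: Rogawski1990, §3.1 p. 19] -/
theorem isLocalStablyConjH_of_classMapH_eq
    {a a' : (UnitaryGroup.cmDatum L 2 (Matrix.of fun i j : Fin 2 => if i.val + j.val + 1 = 2 then (1 : L) else 0)).Local v ×
      (UnitaryGroup.cmDatum L 1 (Matrix.of fun i j : Fin 1 => if i.val + j.val + 1 = 1 then (1 : L) else 0)).Local v}
    (ha : IsLocalGRegular L v a)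
    (h : ((finCharpolyTwo L v a).coeff 0, (finCharpolyTwo L v a).coeff 1, finGammaTwo L v a) =
      ((finCharpolyTwo L v a').coeff 0, (finCharpolyTwo L v a').coeff 1, finGammaTwo L v a')) :
    IsLocalStablyConjH L v a a' := by
  simp only [Prod.mk.injEq] at h
  obtain ⟨h0, h1, hu⟩ := h
  refine isLocalStablyConjH_of_finCharpolyTwo_eq_of_finGammaTwo_eq L v ha ?_ hu
  -- a monic quadratic is determined by its two lower coefficients
  have hdeg : ∀ b : (UnitaryGroup.cmDatum L 2 (Matrix.of fun i j : Fin 2 => if i.val + j.val + 1 = 2 then (1 : L) else 0)).Local v ×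
      (UnitaryGroup.cmDatum L 1 (Matrix.of fun i j : Fin 1 => if i.val + j.val + 1 = 1 then (1 : L) else 0)).Local v,
      finCharpolyTwo L v b = X ^ 2 + C ((finCharpolyTwo L v b).coeff 1) * X + C ((finCharpolyTwo L v b).coeff 0) := fun b => by
    have hm : (finCharpolyTwo L v b).Monic := Matrix.charpoly_monic _
    have hd : (finCharpolyTwo L v b).natDegree = 2 := by
      unfold finCharpolyTwo; rw [Matrix.charpoly_natDegree_eq_dim, Fintype.card_fin]
    conv_lhs => rw [hm.as_sum, hd, Finset.sum_range_succ, Finset.sum_range_one, pow_zero, mul_one, pow_one]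
    ring
  rw [hdeg a, hdeg a', h0, h1]

/-! ## §3 (σ-SAT): every `G`-regular class near `π(ε_H)` meets any neighbourhood of `ε_H` (non-split `v`) -/

/-- In `U(Φ₁)_v` the entry `u` satisfies `ū·u = 1`, so `u⁻¹ = ū`: the inverse matrix of `b` is `(ū)`. [cite: Rogawski1990, §4.9 p. 54] -/
theorem unitaryOne_inv_val_eq (b : (UnitaryGroup.cmDatum L 1 (Matrix.of fun i j : Fin 1 => if i.val + j.val + 1 = 1 then (1 : L) else 0)).Local v) :
    ((b.val : GL (Fin 1) (UnitaryGroup.LocalRing L v))⁻¹).val =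
      Matrix.of fun _ _ : Fin 1 => UnitaryGroup.conjLocal L (IsCMField.complexConj L) v
        (((b.val : GL (Fin 1) (UnitaryGroup.LocalRing L v))).val 0 0) := by
  have hmem : (b.val : GL (Fin 1) (UnitaryGroup.LocalRing L v)) ∈ unitaryGroupOfForm (UnitaryGroup.conjLocal L (IsCMField.complexConj L) v)
      ((Matrix.of fun i j : Fin 1 => if i.val + j.val + 1 = 1 then (1 : L) else 0).map (algebraMap L (UnitaryGroup.LocalRing L v))) := by
    rw [← UnitaryGroup.local_eq_unitaryGroupOfForm_map]; exact b.2
  rw [mem_unitaryGroupOfForm_iff] at hmem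
  have h00 := congr_fun (congr_fun hmem 0) 0
  simp only [Matrix.mul_apply, Fin.sum_univ_one, Matrix.transpose_apply, Matrix.map_apply, Matrix.of_apply, Fin.val_zero, zero_add,
    if_true, map_one, mul_one] at h00
  -- `h00 : σ(u) * u = 1`
  have hinv : ((b.val : GL (Fin 1) (UnitaryGroup.LocalRing L v))).val * (Matrix.of fun _ _ : Fin 1 =>
      UnitaryGroup.conjLocal L (IsCMField.complexConj L) v (((b.val : GL (Fin 1) (UnitaryGroup.LocalRing L v))).val 0 0)) = 1 :=
    Matrix.ext fun i j => by
      fin_cases i; fin_cases j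
      simp only [Matrix.mul_apply, Fin.sum_univ_one, Matrix.of_apply, Fin.zero_eta, Fin.isValue, Matrix.one_apply_eq]
      rw [mul_comm]; exact h00
  rw [Matrix.coe_units_inv]
  exact Matrix.inv_eq_right_inv hinv

/-- **The topology of `U(Φ₁)_v` is induced by the entry `u`**: every neighbourhood of `b₀` contains the fibre of an open set of entries.
[cite: Rogawski1990, §4.9 p. 54] -/
theorem exists_isOpen_entry_subset (b₀ : (UnitaryGroup.cmDatum L 1 (Matrix.of fun i j : Fin 1 => if i.val + j.val + 1 = 1 then (1 : L) else 0)).Local v) {V₂ : Set ((UnitaryGroup.cmDatum L 1 (Matrix.of fun i j : Fin 1 => if i.val + j.val + 1 = 1 then (1 : L) else 0)).Local v)} (hV₂ : V₂ ∈ 𝓝 b₀) :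
    ∃ W₂ : Set (UnitaryGroup.LocalRing L v), IsOpen W₂ ∧ ((b₀.val : GL (Fin 1) (UnitaryGroup.LocalRing L v))).val 0 0 ∈ W₂ ∧
      ∀ b : (UnitaryGroup.cmDatum L 1 (Matrix.of fun i j : Fin 1 => if i.val + j.val + 1 = 1 then (1 : L) else 0)).Local v, ((b.val : GL (Fin 1) (UnitaryGroup.LocalRing L v))).val 0 0 ∈ W₂ → b ∈ V₂ := by
  -- the continuous section `r ↦ ((r), (r̄)ᵒᵖ)` of the units embedding
  set Ψ : UnitaryGroup.LocalRing L v → Matrix (Fin 1) (Fin 1) (UnitaryGroup.LocalRing L v) × (Matrix (Fin 1) (Fin 1) (UnitaryGroup.LocalRing L v))ᵐᵒᵖ :=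
    fun r => (Matrix.of fun _ _ : Fin 1 => r, MulOpposite.op (Matrix.of fun _ _ : Fin 1 => UnitaryGroup.conjLocal L (IsCMField.complexConj L) v r)) with hΨ
  have hΨc : Continuous Ψ := by
    refine Continuous.prodMk (continuous_pi fun _ => continuous_pi fun _ => continuous_id) (MulOpposite.continuous_op.comp ?_)
    exact continuous_pi fun _ => continuous_pi fun _ => UnitaryGroup.continuous_conjLocal L (IsCMField.complexConj L) v
  have hval : ∀ b : (UnitaryGroup.cmDatum L 1 (Matrix.of fun i j : Fin 1 => if i.val + j.val + 1 = 1 then (1 : L) else 0)).Local v, Units.embedProduct _ (b.val : GL (Fin 1) (UnitaryGroup.LocalRing L v)) =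
      Ψ (((b.val : GL (Fin 1) (UnitaryGroup.LocalRing L v))).val 0 0) := fun b => by
    rw [Units.embedProduct_apply, unitaryOne_inv_val_eq L v b, hΨ]
    congr 1
    ext i j; fin_cases i; fin_cases j; rfl
  have hind : IsInducing fun u : (UnitaryGroup.cmDatum L 1 (Matrix.of fun i j : Fin 1 => if i.val + j.val + 1 = 1 then (1 : L) else 0)).Local v => Units.embedProduct _ (u.val : GL (Fin 1) (UnitaryGroup.LocalRing L v)) :=
    Units.isInducing_embedProduct.comp IsInducing.subtypeVal
  rw [hind.nhds_eq_comap, Filter.mem_comap] at hV₂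
  obtain ⟨O, hO, hOV⟩ := hV₂
  rw [hval b₀] at hO
  refine ⟨interior (Ψ ⁻¹' O), isOpen_interior, mem_interior_iff_mem_nhds.2 (hΨc.continuousAt.preimage_mem_nhds hO), fun b hb => hOV ?_⟩
  show Units.embedProduct _ (b.val : GL (Fin 1) (UnitaryGroup.LocalRing L v)) ∈ O
  rw [hval b]
  exact interior_subset (s := Ψ ⁻¹' O) hb

/-- **(σ-SAT) SATURATION ON `H_v`, `v` NON-SPLIT.**  For every `ε_H ∈ H_v = U(Φ₂)_v × U(Φ₁)_v` and every neighbourhood `V ∋ ε_H` there is an OPEN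
`W ∋ π(ε_H)` in `(∏_{w∣v} L_w)³` such that every `G`-REGULAR `γ_H` with `π(γ_H) ∈ W` is stably conjugate (in `H_v`) to some `γ_H′ ∈ V` — «any regular `γ`
close [in class] to `ε` is stably conjugate to a `γ′` close to `ε` because `G` is quasisplit» for `U(2) × U(1)`. [cite: LanglandsShelstad1990Descent, §2.2 p. 11]
[cite: Rogawski1990, §3.1 p. 19] -/
theorem exists_isOpen_classMapH_saturation (w : UnitaryGroup.PlacesOver L v) (hw : IsCMField.complexConj L • w.1 = w.1) (εH : (UnitaryGroup.cmDatum L 2 (Matrix.of fun i j : Fin 2 => if i.val + j.val + 1 = 2 then (1 : L) else 0)).Local v × (UnitaryGroup.cmDatum L 1 (Matrix.of fun i j : Fin 1 => if i.val + j.val + 1 = 1 then (1 : L) else 0)).Local v)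
    {V : Set ((UnitaryGroup.cmDatum L 2 (Matrix.of fun i j : Fin 2 => if i.val + j.val + 1 = 2 then (1 : L) else 0)).Local v × (UnitaryGroup.cmDatum L 1 (Matrix.of fun i j : Fin 1 => if i.val + j.val + 1 = 1 then (1 : L) else 0)).Local v)} (hV : V ∈ 𝓝 εH) :
    ∃ W : Set (UnitaryGroup.LocalRing L v × UnitaryGroup.LocalRing L v × UnitaryGroup.LocalRing L v), IsOpen W ∧
      ((finCharpolyTwo L v εH).coeff 0, (finCharpolyTwo L v εH).coeff 1, finGammaTwo L v εH) ∈ W ∧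
      ∀ γ : (UnitaryGroup.cmDatum L 2 (Matrix.of fun i j : Fin 2 => if i.val + j.val + 1 = 2 then (1 : L) else 0)).Local v × (UnitaryGroup.cmDatum L 1 (Matrix.of fun i j : Fin 1 => if i.val + j.val + 1 = 1 then (1 : L) else 0)).Local v, IsLocalGRegular L v γ → ((finCharpolyTwo L v γ).coeff 0, (finCharpolyTwo L v γ).coeff 1, finGammaTwo L v γ) ∈ W →
        ∃ γ' ∈ V, IsLocalStablyConjH L v γ γ' := by
  -- a product neighbourhood `O₁ ×ˢ V₂ ⊆ V`, `O₁` open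
  obtain ⟨V₁, hV₁, V₂, hV₂, hprod⟩ := mem_nhds_prod_iff.1 hV
  obtain ⟨O₁, hO₁V₁, hO₁o, hεO₁⟩ := mem_nhds_iff.1 hV₁
  -- the `U(Φ₂)` slot: ★ openness of `(tr, det)` at `ε_H.1`
  obtain ⟨W₁, hW₁, hW₁p⟩ := UnitaryGroup.exists_nhds_class_local_two_nonsplit L v w hw εH.1 hO₁o hεO₁
  -- the `U(Φ₁)` slot: entries
  obtain ⟨W₂, hW₂o, hεW₂, hW₂p⟩ := exists_isOpen_entry_subset L v εH.2 hV₂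
  -- `W`: pull back `interior W₁ ×ˢ W₂` along `(c₀, c₁, u) ↦ ((−c₁, c₀), u)`
  have hθ : Continuous fun q : UnitaryGroup.LocalRing L v × UnitaryGroup.LocalRing L v × UnitaryGroup.LocalRing L v => ((-q.2.1, q.1), q.2.2) :=
    ((continuous_snd.fst.neg).prodMk continuous_fst).prodMk continuous_snd.snd
  refine ⟨(fun q : UnitaryGroup.LocalRing L v × UnitaryGroup.LocalRing L v × UnitaryGroup.LocalRing L v => ((-q.2.1, q.1), q.2.2)) ⁻¹'
      (interior W₁ ×ˢ W₂), (isOpen_interior.prod hW₂o).preimage hθ, ?_, fun γ hγ hγW => ?_⟩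
  · rw [Set.mem_preimage, Set.mem_prod]
    refine ⟨?_, hεW₂⟩
    rw [(finCharpolyTwo_coeff_eq L v εH).1, (finCharpolyTwo_coeff_eq L v εH).2, neg_neg]
    exact mem_interior_iff_mem_nhds.2 hW₁
  · rw [Set.mem_preimage, Set.mem_prod, (finCharpolyTwo_coeff_eq L v γ).1, (finCharpolyTwo_coeff_eq L v γ).2, neg_neg] at hγW
    obtain ⟨h1, h2⟩ := hγW
    obtain ⟨g', hg'O₁, htr, hdet⟩ := hW₁p γ.1 (interior_subset h1)
    refine ⟨(g', γ.2), hprod ⟨hO₁V₁ hg'O₁, hW₂p γ.2 h2⟩, ?_⟩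
    refine isLocalStablyConjH_of_classMapH_eq L v hγ ?_
    -- same `(det, −tr)` and same `u`
    rw [(finCharpolyTwo_coeff_eq L v γ).1, (finCharpolyTwo_coeff_eq L v γ).2, (finCharpolyTwo_coeff_eq L v (g', γ.2)).1,
      (finCharpolyTwo_coeff_eq L v (g', γ.2)).2]
    show (_, _, finGammaTwo L v γ) = (((g' : (UnitaryGroup.cmDatum L 2 (Matrix.of fun i j : Fin 2 => if i.val + j.val + 1 = 2 then (1 : L) else 0)).Local v).val : GL (Fin 2) (UnitaryGroup.LocalRing L v)).val.det,
      -((g' : (UnitaryGroup.cmDatum L 2 (Matrix.of fun i j : Fin 2 => if i.val + j.val + 1 = 2 then (1 : L) else 0)).Local v).val : GL (Fin 2) (UnitaryGroup.LocalRing L v)).val.trace, finGammaTwo L v γ)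
    rw [htr, hdet]

end Literature.NumberTheory.Rogawski1990

end
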